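import Summits.CriticalPhenomena.PercolationContinuityZ3.Theorems.PercNecklaceBackboneTruncatedSusceptibilityFiniteOfThetaOfThinDust
import Summits.CriticalPhenomena.PercolationContinuityZ3.Theorems.PercBudgetLadderBudgetTightnessStubCritCrossing
import Summits.CriticalPhenomena.PercolationContinuityZ3.Theses.PercDebrisSweep
import Summits.CriticalPhenomena.PercolationContinuityZ3.Theses.PercVarianceSandwich
import Literature.Barriers.CriticalPhenomena.KozmaNachmiasLemma23B3
import HarnessLib

/-!
# Crux `TruncatedSusceptibilityFiniteOfTheta` (stmt-CriticalPhenomena-0852): the registered open stub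
# `stub_criticalRadiusMoment` and the crux from the sibling "thin critical dust" cruxes, and tightness
# of the stub's conclusion

Lead prover-line-stmt-CriticalPhenomena-0852-c3-0 (line `registered`, continuation c3), 2026-08-17.
Kernel-checked bookkeeping placing crux 0852 at the BOTTOM of the family of jump-world statements
"finite clusters at a percolating `p_c(ℤ³)` are small" used across `PercolationContinuityZ3`:

* `real_finiteArm_le_real_clusterSizeGe_finite` — a finite cluster with an arm to `∂B(n)` has at least
  `n + 1` sites: `P_p(0 ↔ ∂B(n), |C(0)| < ∞) ≤ P_p(n+1 ≤ |C(0)| < ∞)` (the volume event spelled with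
  `(openCluster ω 0).encard` / `.Finite`, exactly as in crux `FiniteClusterVolumeTail`, stmt-CriticalPhenomena-0943);
* `stub_criticalRadiusMoment_of_volumeTail` — hence the `p_c`-instance of 0943 (Kesten–Zhang surface-order
  tail `exp(−c m^{2/3})` at the same `p`) gives the registered stub, through the landed polynomial form
  `stub_criticalRadiusMoment_of_rpow_decay` (p156696) with `η = 1`, using `exp(−x) ≤ 6!/x⁶`;
* `TruncatedSusceptibilityFiniteOfTheta_of_FiniteClusterVolumeTail` (three route spellings) — crux 0943 ⇒ crux 0852;
* `TruncatedSusceptibilityFiniteOfTheta_of_FiniteClusterMomentsOfTheta` — crux stmt-CriticalPhenomena-6065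
  (all truncated moments) ⇒ crux 0852, its `k = 1` instance (reindexing `Fin 1 → Site 3 ≃ Site 3`);
* `stub_theta_pos_of_radiusMoment` — TIGHTNESS of the stub: its conclusion
  `Σ_n (n+1)² P_{p_c}(0 ↔ ∂B(n), |C(0)| < ∞) < ∞` already forces `θ(p_c) > 0`, because at a continuous `p_c`
  the truncation is vacuous and `P_{p_c}(0 ↔ ∂B(n)) ≥ 1/(36(2n+1)²)` (`φ_{p_c}(B(n)) ≥ 1`, in tree as
  `BudgetTightness.StubCritCrossing.one_le_mul_real_siteToBoundary`), so the terms do not even tend to `0`.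
  Hence the stub cannot be settled by proving its conclusion outright: it is EQUIVALENT to
  `θ(p_c) > 0 ↔ Σ_n (n+1)² P_{p_c}(0 ↔ ∂B(n), |C(0)| < ∞) < ∞` (`stub_criticalRadiusMoment_iff`).

With the earlier reductions (0853@p_c ⇒ stub, p150587; thin dust / `O(n^{-3-η})` ⇒ stub, p156696) crux 0852 is now
checkably implied by each of 0853, 0943, 6065 and 7204's `stub_thinDust`. No new definitions.
-/

noncomputable section

namespace Summit.CriticalPhenomena.PercolationContinuityZ3.Theorems.TruncatedSusceptibilityFiniteOfTheta

open MeasureTheory Literature.Probability.Percolation Literature.Probability.LatticeModels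
open Literature.Probability.Percolation.DCT16

/-! ## Radius events sit inside volume events -/

/-- **An arm costs volume**: for bond percolation on `ℤ³` at any `p`,
`P_p(0 ↔ ∂B(n), |C(0)| < ∞) ≤ P_p(n + 1 ≤ |C(0)|, |C(0)| < ∞)` — a.s. (`ω ⊆ E(ℤ³)`) an open path from `0`
to `∂B(n)` meets the `n + 1` disjoint spheres `∂B(0), …, ∂B(n)`
(`Literature.Barriers.CriticalPhenomena.mem_clusterSizeGe_of_mem_siteToBoundary`). [folklore] -/
theorem real_finiteArm_le_real_clusterSizeGe_finite (p : unitInterval) (n : ℕ) :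
    (bondPercolation (zdGraph 3) p).real (siteToBoundary 3 n \ percolatesAt 0) ≤
      (bondPercolation (zdGraph 3) p).real
        {ω | (((n + 1 : ℕ) : ℕ∞)) ≤ (openCluster ω 0).encard ∧ (openCluster ω 0).Finite} := by
  refine real_mono_of_forall_subset_edgeSet (zdGraph 3) p fun ω hω h => ⟨?_, ?_⟩
  · exact Literature.Barriers.CriticalPhenomena.mem_clusterSizeGe_of_mem_siteToBoundary
      (d := 3) (by norm_num) hω h.1
  · exact Set.not_infinite.1 h.2

/-- `exp(−x) ≤ 720 / x⁶` for `x > 0` (from `x⁶/6! ≤ exp x`). [folklore] -/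
theorem exp_neg_le_div_pow_six {x : ℝ} (hx : 0 < x) : Real.exp (-x) ≤ 720 / x ^ 6 := by
  have h := Real.pow_div_factorial_le_exp x hx.le 6
  have h6 : ((Nat.factorial 6 : ℕ) : ℝ) = 720 := by norm_num [Nat.factorial]
  rw [h6] at h
  rw [Real.exp_neg, inv_eq_one_div, div_le_div_iff₀ (Real.exp_pos x) (by positivity)]
  rw [div_le_iff₀ (by norm_num : (0 : ℝ) < 720)] at h
  linarith

/-! ## The registered stub from the surface-order volume tail at `p_c` (crux 0943 at `p = p_c`) -/

/-- **Kesten–Zhang tails at a percolating `p_c` give the registered stub `stub_criticalRadiusMoment`.**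
If `θ(p_c(ℤ³)) > 0` implies `P_{p_c}(m ≤ |C(0)| < ∞) ≤ exp(−c m^{2/3})` for all `m ≥ 1` (the `p = p_c`
instance of crux `FiniteClusterVolumeTail`, stmt-CriticalPhenomena-0943), then `θ(p_c) > 0` implies
`Σ_n (n+1)² P_{p_c}(0 ↔ ∂B(n), |C(0)| < ∞) < ∞`: by `real_finiteArm_le_real_clusterSizeGe_finite` and
`exp(−c (n+1)^{2/3}) ≤ 720 c^{-6} (n+1)^{-4}`, the polynomial criterion
`stub_criticalRadiusMoment_of_rpow_decay` applies with `η = 1`. [folklore] -/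
theorem stub_criticalRadiusMoment_of_volumeTail : (0 < theta (zdGraph 3) (0 : Site 3) (criticalProbI 3) → ∃ c : ℝ, 0 < c ∧ ∀ m : ℕ, 1 ≤ m → (bondPercolation (zdGraph 3) (criticalProbI 3)).real {ω | (m : ℕ∞) ≤ (openCluster ω 0).encard ∧ (openCluster ω 0).Finite} ≤ Real.exp (-(c * (m : ℝ) ^ ((2 : ℝ) / 3)))) → 0 < theta (zdGraph 3) (0 : Site 3) (criticalProbI 3) → Summable fun n : ℕ => ((n : ℝ) + 1) ^ 2 * (bondPercolation (zdGraph 3) (criticalProbI 3)).real (siteToBoundary 3 n \ percolatesAt 0) := by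
  intro hK
  refine stub_criticalRadiusMoment_of_rpow_decay fun hθ => ?_
  obtain ⟨c, hc, hle⟩ := hK hθ
  refine ⟨1, one_pos, 720 / c ^ 6, fun n => ?_⟩
  have hn : (0 : ℝ) < (n : ℝ) + 1 := by positivity
  have hm : (1 : ℕ) ≤ n + 1 := Nat.succ_le_succ (Nat.zero_le n)
  have hcast : ((n + 1 : ℕ) : ℝ) = (n : ℝ) + 1 := by push_cast; ring
  -- the volume bound at `m = n + 1`
  have h1 := (real_finiteArm_le_real_clusterSizeGe_finite (criticalProbI 3) n).trans (hle (n + 1) hm)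
  rw [hcast] at h1
  refine h1.trans ?_
  -- `exp(-c t) ≤ 720/(c t)^6` with `t = (n+1)^{2/3}`, and `t^6 = (n+1)^4`
  have ht : (0 : ℝ) < ((n : ℝ) + 1) ^ ((2 : ℝ) / 3) := Real.rpow_pos_of_pos hn _
  have hct : 0 < c * ((n : ℝ) + 1) ^ ((2 : ℝ) / 3) := mul_pos hc ht
  refine (exp_neg_le_div_pow_six hct).trans_eq ?_
  have ht6 : (((n : ℝ) + 1) ^ ((2 : ℝ) / 3)) ^ 6 = ((n : ℝ) + 1) ^ (4 : ℝ) := by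
    rw [← Real.rpow_mul_natCast hn.le]
    norm_num
  have hneg : ((n : ℝ) + 1) ^ (-(3 + 1 : ℝ)) = (((n : ℝ) + 1) ^ (4 : ℝ))⁻¹ := by
    rw [Real.rpow_neg hn.le]; norm_num
  rw [mul_pow, ht6, hneg]
  field_simp

/-- **Crux 0943 ⇒ the registered stub** (the full `∀ p` statement `FiniteClusterVolumeTail`, home spelling
`PercDebrisSweep`, specialised to `p = p_c`). [folklore] -/
theorem stub_criticalRadiusMoment_of_FiniteClusterVolumeTail
    (hK : Summit.CriticalPhenomena.PercolationContinuityZ3.Theses.PercDebrisSweep.FiniteClusterVolumeTail) :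
    0 < theta (zdGraph 3) (0 : Site 3) (criticalProbI 3) →
      Summable fun n : ℕ => ((n : ℝ) + 1) ^ 2 *
        (bondPercolation (zdGraph 3) (criticalProbI 3)).real (siteToBoundary 3 n \ percolatesAt 0) :=
  stub_criticalRadiusMoment_of_volumeTail (hK (criticalProbI 3))

/-- **Crux 0943 `FiniteClusterVolumeTail` ⇒ crux 0852 `TruncatedSusceptibilityFiniteOfTheta`**
(through `TruncatedSusceptibilityFiniteOfTheta_of_criticalRadiusMoment`, p150587). [folklore] -/
theorem TruncatedSusceptibilityFiniteOfTheta_of_FiniteClusterVolumeTail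
    (hK : Summit.CriticalPhenomena.PercolationContinuityZ3.Theses.PercDebrisSweep.FiniteClusterVolumeTail) :
    Summit.CriticalPhenomena.PercolationContinuityZ3.Theses.PercNecklaceBackbone.TruncatedSusceptibilityFiniteOfTheta :=
  TruncatedSusceptibilityFiniteOfTheta_of_criticalRadiusMoment
    (stub_criticalRadiusMoment_of_FiniteClusterVolumeTail hK)

/-- The same for the crux's home-route spelling (`PercTruncatedSusceptibility`; shared item, identical text). [folklore] -/
theorem TruncatedSusceptibilityFiniteOfTheta_of_FiniteClusterVolumeTail'
    (hK : Summit.CriticalPhenomena.PercolationContinuityZ3.Theses.PercDebrisSweep.FiniteClusterVolumeTail) :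
    Summit.CriticalPhenomena.PercolationContinuityZ3.Theses.PercTruncatedSusceptibility.TruncatedSusceptibilityFiniteOfTheta :=
  TruncatedSusceptibilityFiniteOfTheta_of_FiniteClusterVolumeTail hK

/-- The same for the third route spelling (`PercAntiMeanFieldOnset`; shared item, identical text). [folklore] -/
theorem TruncatedSusceptibilityFiniteOfTheta_of_FiniteClusterVolumeTail''
    (hK : Summit.CriticalPhenomena.PercolationContinuityZ3.Theses.PercDebrisSweep.FiniteClusterVolumeTail) :
    Summit.CriticalPhenomena.PercolationContinuityZ3.Theses.PercAntiMeanFieldOnset.TruncatedSusceptibilityFiniteOfTheta :=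
  TruncatedSusceptibilityFiniteOfTheta_of_FiniteClusterVolumeTail hK

/-! ## The crux from all truncated moments (crux 6065 at `k = 1`) -/

/-- **Crux 6065 `FiniteClusterMomentsOfTheta` ⇒ crux 0852**: the case `k = 1` of "all truncated moments of
`|C(0)|` are finite wherever `θ > 0`" is `χᶠ(p) < ∞`, after reindexing `(Fin 1 → Site 3) ≃ Site 3`
(`Equiv.funUnique`) and `⋂ i : Fin 1, {0 ↔ x i} = {0 ↔ x 0}`. [folklore] -/
theorem TruncatedSusceptibilityFiniteOfTheta_of_FiniteClusterMomentsOfTheta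
    (hB : Summit.CriticalPhenomena.PercolationContinuityZ3.Theses.PercVarianceSandwich.FiniteClusterMomentsOfTheta) :
    Summit.CriticalPhenomena.PercolationContinuityZ3.Theses.PercNecklaceBackbone.TruncatedSusceptibilityFiniteOfTheta := by
  intro p hθ
  have h1 := hB p hθ 1
  -- reindex along `Site 3 ≃ (Fin 1 → Site 3)`
  have h2 := (Equiv.summable_iff (Equiv.funUnique (Fin 1) (Site 3)).symm).2 h1
  refine h2.congr fun x => ?_
  simp only [Function.comp_apply]
  congr 1
  ext ω
  simp only [Set.mem_sdiff, Set.mem_iInter]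
  constructor
  · rintro ⟨h, hfin⟩
    exact ⟨by simpa using h 0, hfin⟩
  · rintro ⟨h, hfin⟩
    refine ⟨fun i => ?_, hfin⟩
    have hi : i = 0 := Subsingleton.elim i 0
    subst hi
    simpa using h

/-- Home-route spelling of `TruncatedSusceptibilityFiniteOfTheta_of_FiniteClusterMomentsOfTheta`. [folklore] -/
theorem TruncatedSusceptibilityFiniteOfTheta_of_FiniteClusterMomentsOfTheta'
    (hB : Summit.CriticalPhenomena.PercolationContinuityZ3.Theses.PercVarianceSandwich.FiniteClusterMomentsOfTheta) :
    Summit.CriticalPhenomena.PercolationContinuityZ3.Theses.PercTruncatedSusceptibility.TruncatedSusceptibilityFiniteOfTheta :=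
  TruncatedSusceptibilityFiniteOfTheta_of_FiniteClusterMomentsOfTheta hB

/-! ## Tightness: the stub's conclusion already forces the jump world -/

/-- **At a continuous critical point the truncated radius moment is infinite**: if `θ(p_c(ℤ³)) = 0` then
`Σ_n (n+1)² P_{p_c}(0 ↔ ∂B(n), |C(0)| < ∞)` DIVERGES — the truncation is vacuous (`{|C(0)| = ∞}` is null) and
`(n+1)² P_{p_c}(0 ↔ ∂B(n)) ≥ (n+1)²/(36 (2n+1)²) ≥ 1/144` by the Hammersley–Duminil-Copin–Tassion bound
`φ_{p_c}(B(n)) ≥ 1` (in tree: `BudgetTightness.StubCritCrossing.one_le_mul_real_siteToBoundary`), so the terms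
do not tend to `0`. [folklore] -/
theorem not_summable_radiusMoment_of_theta_eq_zero
    (h0 : theta (zdGraph 3) (0 : Site 3) (criticalProbI 3) = 0) :
    ¬ Summable fun n : ℕ => ((n : ℝ) + 1) ^ 2 *
        (bondPercolation (zdGraph 3) (criticalProbI 3)).real (siteToBoundary 3 n \ percolatesAt 0) := by
  intro hsum
  set μ := bondPercolation (zdGraph 3) (criticalProbI 3) with hμ
  -- the truncation is vacuous
  have hnull : μ (percolatesAt 0) = 0 := by
    have : μ.real (percolatesAt 0) = 0 := h0
    exact (measureReal_eq_zero_iff (measure_ne_top μ _)).1 this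
  have hdiff : ∀ n : ℕ, μ.real (siteToBoundary 3 n \ percolatesAt 0) = μ.real (siteToBoundary 3 n) := by
    intro n
    simp only [measureReal_def, measure_sdiff_null hnull]
  -- terms are bounded below by 1/144
  have hlow : ∀ n : ℕ, (1 : ℝ) / 144 ≤ ((n : ℝ) + 1) ^ 2 * μ.real (siteToBoundary 3 n \ percolatesAt 0) := by
    intro n
    rw [hdiff n]
    have h := BudgetTightness.StubCritCrossing.one_le_mul_real_siteToBoundary n
    have hnn : 0 ≤ μ.real (siteToBoundary 3 n) := measureReal_nonneg
    have hn0 : (0 : ℝ) ≤ (n : ℝ) := n.cast_nonneg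
    have hsq : (2 * (n : ℝ) + 1) ^ 2 ≤ 4 * ((n : ℝ) + 1) ^ 2 := by nlinarith
    rw [div_le_iff₀ (by norm_num : (0 : ℝ) < 144)]
    calc (1 : ℝ) ≤ 36 * (2 * (n : ℝ) + 1) ^ 2 * μ.real (siteToBoundary 3 n) := h
      _ ≤ 36 * (4 * ((n : ℝ) + 1) ^ 2) * μ.real (siteToBoundary 3 n) := by gcongr
      _ = ((n : ℝ) + 1) ^ 2 * μ.real (siteToBoundary 3 n) * 144 := by ring
  have hlim := hsum.tendsto_atTop_zero
  have hev := (hlim.eventually (gt_mem_nhds (show (0 : ℝ) < 1 / 144 by norm_num)))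
  obtain ⟨N, hN⟩ := hev.exists_forall_of_atTop
  exact absurd (hN N le_rfl) (not_lt.2 (hlow N))

/-- **Tightness of `stub_criticalRadiusMoment`**: its conclusion implies its hypothesis —
`Σ_n (n+1)² P_{p_c}(0 ↔ ∂B(n), |C(0)| < ∞) < ∞ ⇒ θ(p_c) > 0`. [folklore] -/
theorem stub_theta_pos_of_radiusMoment : (Summable fun n : ℕ => ((n : ℝ) + 1) ^ 2 * (bondPercolation (zdGraph 3) (criticalProbI 3)).real (siteToBoundary 3 n \ percolatesAt 0)) → 0 < theta (zdGraph 3) (0 : Site 3) (criticalProbI 3) := by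
  intro hsum
  rcases (measureReal_nonneg : 0 ≤ theta (zdGraph 3) (0 : Site 3) (criticalProbI 3)).eq_or_lt with h | h
  · exact absurd hsum (not_summable_radiusMoment_of_theta_eq_zero h.symm)
  · exact h

/-- **The registered stub is an equivalence claim**: `stub_criticalRadiusMoment` (as registered:
`θ(p_c) > 0 → Σ (n+1)² P_{p_c}(0 ↔ ∂B(n), |C(0)| < ∞) < ∞`) holds iff
`θ(p_c) > 0 ↔ Σ (n+1)² P_{p_c}(0 ↔ ∂B(n), |C(0)| < ∞) < ∞`; in particular it is vacuous exactly in the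
continuous world and cannot be obtained by proving its conclusion unconditionally. [folklore] -/
theorem stub_criticalRadiusMoment_iff :
    (0 < theta (zdGraph 3) (0 : Site 3) (criticalProbI 3) →
        Summable fun n : ℕ => ((n : ℝ) + 1) ^ 2 *
          (bondPercolation (zdGraph 3) (criticalProbI 3)).real (siteToBoundary 3 n \ percolatesAt 0)) ↔
      (0 < theta (zdGraph 3) (0 : Site 3) (criticalProbI 3) ↔
        Summable fun n : ℕ => ((n : ℝ) + 1) ^ 2 *
          (bondPercolation (zdGraph 3) (criticalProbI 3)).real (siteToBoundary 3 n \ percolatesAt 0)) :=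
  ⟨fun h => ⟨h, stub_theta_pos_of_radiusMoment⟩, fun h => h.1⟩

end Summit.CriticalPhenomena.PercolationContinuityZ3.Theorems.TruncatedSusceptibilityFiniteOfTheta

end
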